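import Literature.Computability.QuantumComplexity.CoinPrefix
import Literature.Computability.QuantumComplexity.PolyCopiesIdxLaw
import Literature.Computability.QuantumComplexity.PolyCopiesIdxUniform
import Literature.Computability.Cryptography.LWEAmplifyAnswer
import Literature.Computability.Cryptography.LWEAmplifyPost
import Literature.Computability.Cryptography.LWEAmplifyProb
import Literature.Computability.Cryptography.RegevDGSReductionWorstCase
import Literature.Computability.Cryptography.QuantumCircuitDescFP
import HarnessLib

/-!
# The average-case-to-worst-case bridge for search-LWE, V: the amplified solver and the theorem

Topic `Computability/Cryptography` (LWE), grouping namespace `LWE.AmpBricks` (machine) and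
`Regev2009` (the exported theorem). This file DISCHARGES hypothesis `h₁` of
`Literature.Computability.Cryptography.regev_lwe_to_sivp_quantum_of_worstCase`
(`RegevDGSReductionWorstCase.lean`; the same hypothesis appears verbatim in the GapSVP assemblies
`RegevReduction.lean`, `RegevReductionGMSS.lean`) as a THEOREM,
**`Regev2009.searchLWE_worstCase_of_avgCase`**: from ONE poly-time uniform quantum family solving
search-`LWE_{q,Ψ̄_α}` on `m(n)` samples with AVERAGE-case success probability `≥ 2/3` for all large `n`,
a poly-time uniform quantum family `W` solving it for EVERY secret with probability `≥ 1 − 2^{-n}` on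
`m'(n) = 18(n+1) · m(n)` samples (Regev 2009, §2 p. 12: an algorithm *solves* `LWE_{p,χ}` if for ANY
`s`, given samples from `A_{s,χ}`, it outputs `s` with probability exponentially close to `1`; the paper's
tool is the shift `(a, b) ↦ (a, b + ⟨a, t⟩)` of the proof of Lemma 4.1, which maps `A_{s,χ}` to
`A_{s+t,χ}` with `s + t` uniform; amplification by repetition and majority is standard, Arora–Barak
2009 §7.4.1).

## The machine (`LWE.AmpBricks.Machine`, `nonempty_machine`)

`W = CWrap(hPre, MID, majorityG pF)` with `hPre x = ⟨x, ε⟩` and `MID = PolyCopiesIdx.family ⟨C, pF, ·, X⟩`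
(`|u| + 1` indexed copies of the ATTEMPT family `C` on `u = ⟨x, ε⟩`), where
`C = CoinPrefix(CWrap(queryZ, Q, answerG))` (`QuantumComplexity/CoinPrefix.lean`,
`CoinCWrap.exists_family`): attempt `j` draws `2|v|²` Hadamard coins, shifts batch `j` of the samples by
the vector read off the coins (`LWEAmplifyQuery.queryZ`), runs the given family `Q` and returns the
canonical code of (answer − shift) (`LWEAmplifyAnswer.answerG`); the outer post-processor takes the
majority of the first `K₀(n) = 18(n+1)` candidates (`LWEAmplifyPost.majorityG`). All of it is ONE
poly-time uniform oracle-free Clifford+T family (`Machine.W`).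

## The estimate (`Machine.success_ge`) and its steps

* A (`majEvent_le_success`): success `≥ Pr_MID[majority map returns encodeSecret s]`
  (`CWrap.kernelProb_family_ge`);
* B (`goodEvent_subset_majEvent`): "more than half of the first `K₀` segments carry `encodeSecret s`"
  implies that (`majorityG_eq_of_majority`, layout identities `blk_uIn`, `K_uIn`);
* C (`goodEvent_compl_le`): the segments are independent (`PolyCopiesIdx.kernel_map_segments`), so the
  complement has probability `≤ ∏_{j<K₀} (1 + φⱼ)/(√2)^{K₀}` (`indepLaw_toOuterMeasure_half_le_finset`);
* D (`one_add_φ_le`): `1 + φⱼ ≤ ψ(batch j) = 2 − 2^{-L} Σ_c Pr[Q answers s + t_c on batch j shifted by t_c]`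
  (`Machine.hC`, `inputIdx_append`, `queryZ_zOf`, `answerG_apply_of_decode`; only the first
  `L = n · Kw` coins matter, `sum_qreg_take_eq`);
* E (`tsum_ψR_eq`, `tsum_ψR_le`, `tsum_fail_eq`): over the samples the blocks are independent
  (`tsum_iidPMF_mul_prod_blocksOf`), each shifted block is a fresh instance with secret `s + t`
  (`searchSuccessProbOf_shift`), the shift is `n/2ⁿ`-uniform (`avg_shiftOfCoins_le`), and the uniform
  average is the average-case success (`avg_searchSuccessProbOf_add`): `E[ψ] ≤ 4/3 + n/2ⁿ`;
* F (`final_bound`): `(1.3431)^{18(n+1)}/(√2)^{18(n+1)} ≤ 2^{-(n+1)}` for `n ≥ 10`;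
* G (`success_ge`): success `≥ 1 − 2^{-(n+1)}` for every secret; the theorem adds the parameters
  (`isPolyBounded_K0_mul`, `isPolyTimeParams_K0_mul`) and the degenerate cases `q n = 1`
  (one secret) and `m n = 0` (impossible under the hypothesis).

Everything here is PROVED (definitions with bodies, theorems; no named fact, no new hypothesis).

## References

* O. Regev, *On lattices, learning with errors, random linear codes, and cryptography*, J. ACM 56
  (2009), art. 34 (author's version arXiv:2401.03703): §2 p. 12 ("Learning with errors": solving
  `LWE_{p,χ}`), §4 proof of Lemma 4.1 (p. 23: the shift `(a, b) ↦ (a, b + ⟨a, t⟩)`) [Regev2009].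
* S. Arora, B. Barak, *Computational Complexity: A Modern Approach*, CUP 2009, §7.4.1 (error reduction
  by repetition and majority), §1.3 [AroraBarak2009].
* E. Bernstein, U. Vazirani, *Quantum complexity theory*, SIAM J. Comput. 26 (1997), §8 (classical
  computation inside quantum machines) [BernsteinVazirani1997].
* M. A. Nielsen, I. L. Chuang, *Quantum Computation and Quantum Information*, CUP 2010, §2.2.8
  [NielsenChuang2010].
-/

noncomputable section

namespace Literature.Computability.Cryptography

namespace LWE

namespace AmpBricks

open _root_.Computability Polynomial Literature.Computability.Complexity Brick Plumb HashBricks QuantumComplexity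
open Filter Literature.Probability.Distributions
open scoped ENNReal Classical

/-! ### The machine -/

section Construction

/-- **The outer pre-processor**: `x ↦ ⟨x, ε⟩` (so that the index word appended by the copies family
lands in the second pair component). [folklore] -/
def hPre : List Bool → List Bool := fanoutFn (fun x => x) fun _ => []

/-- `hPre ∈ FP`. [folklore] -/
theorem hPre_mem_FP : hPre ∈ FP := fanoutFn_mem_FP OracleCompose.id_mem_FP (const_mem_FP _)

/-- Value of `hPre`. [folklore] -/
@[simp] theorem hPre_apply (x : List Bool) : hPre x = boolPair x [] := by simp [hPre]

/-- **The coin polynomial of an attempt**: `2 |v|²` coins on the attempt input `v` (`≥ n · Kw`, the bits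
the shift reads). [folklore] -/
def pcA : Polynomial ℕ := 2 * X ^ 2

/-- Value of `pcA`. [folklore] -/
@[simp] theorem eval_pcA (N : ℕ) : pcA.eval N = 2 * N ^ 2 := by simp [pcA]

/-- Appending to a pair with empty second component fills the second component. [folklore] -/
theorem boolPair_nil_append (x w : List Bool) : boolPair x [] ++ w = boolPair x w := by
  simp [boolPair]

/-- The one-hot word as an `ofFn` of a `decide`. [folklore] -/
theorem ofFn_decide_eq_oneHot {Kc j : ℕ} (hj : j < Kc) :
    (List.ofFn fun j' : Fin Kc => decide ((j' : ℕ) = j)) = oneHot Kc j := by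
  apply List.ext_getElem
  · rw [List.length_ofFn, length_oneHot hj]
  · intro i h1 h2
    rw [List.getElem_ofFn]
    simp only [oneHot]
    rcases lt_trichotomy i j with h | h | h
    · rw [List.getElem_append_left (by simp [h])]
      simp [h.ne]
    · subst h
      rw [List.getElem_append_right (by simp)]
      simp
    · rw [List.getElem_append_right (by simp; omega)]
      have : i - (List.replicate j false).length = (i - j - 1) + 1 := by simp; omega
      simp only [this, List.getElem_cons_succ, List.getElem_replicate]
      simp [h.ne']

/-- **The constructed machine and its guarantees** (a record of the choices made along the
construction: the attempt family `C` with the coin-averaged classical-wrap bound, its ancilla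
polynomial, and the parameters of the outer classical wrap around the indexed copies of `C`).
[folklore] -/
structure Machine (Q : UniformQCircuitFamily) where
  /-- the attempt family: coins, query generator, the given solver, answer map -/
  C : QCircuitFamily cliffordT
  /-- it is oracle-free -/
  hCfree : C.IsOracleFree
  /-- it is uniform -/
  hCunif : C.IsUniform
  /-- the coin-averaged bound of the attempt family -/
  hC : ∀ (v : List Bool) (S' : QReg (pcA.eval v.length) → Set (List Bool)),
    (1 / 2 : ℝ) ^ pcA.eval v.length *
        ∑ c : QReg (pcA.eval v.length), Q.family.kernelProb 0 (queryZ (v ++ List.ofFn c)) (S' c) ≤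
      C.kernelProb 0 v {z | ∃ c : QReg (pcA.eval v.length), ∃ y ∈ S' c, answerG (boolPair (v ++ List.ofFn c) y) <+: z}
  /-- a polynomial bound of its ancillas -/
  pF : Polynomial ℕ
  /-- the bound -/
  hpF : ∀ k, C.ancillas k ≤ pF.eval k
  /-- the parameters of the outer classical wrap -/
  Pout : CWrap.Params
  /-- its pre-processor is `hPre` -/
  hPh : Pout.h = hPre
  /-- its post-processor is the majority map -/
  hPg : Pout.g = majorityG pF
  /-- it wraps the indexed copies of `C` (`|u| + 1` copies on `u`) -/
  hPF : Pout.F = PolyCopiesIdx.family ⟨C, pF, hpF, X⟩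

namespace Machine

variable {Q : UniformQCircuitFamily} (M : Machine Q)

/-- The parameters of the indexed copies. [folklore] -/
def PP : PolyCopies.Params := ⟨M.C, M.pF, M.hpF, X⟩

/-- The indexed-copies family. [folklore] -/
def MID : QCircuitFamily cliffordT := PolyCopiesIdx.family M.PP

/-- The outer wrap wraps `MID`. [folklore] -/
theorem hPF' : M.Pout.F = M.MID := M.hPF

/-- `MID` is uniform. [folklore] -/
theorem MID_isUniform : M.MID.IsUniform := PolyCopiesIdx.family_isUniform M.PP M.hCunif

/-- `MID` is oracle-free. [folklore] -/
theorem MID_isOracleFree : M.MID.IsOracleFree := PolyCopiesIdx.family_isOracleFree M.PP M.hCfree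

/-- **The amplified solver**: the outer classical wrap, a poly-time uniform oracle-free family.
[cite: Regev2009, §2 p. 12 ("an algorithm solves LWE")] -/
def W : UniformQCircuitFamily where
  family := CWrap.family M.Pout
  isOracleFree := CWrap.family_isOracleFree M.Pout (by rw [M.hPF']; exact M.MID_isOracleFree)
  isUniform := CWrap.family_isUniform M.Pout (by rw [M.hPF']; exact M.MID_isUniform)

end Machine

/-- **The machine exists** (all the choices can be made). [folklore] -/
theorem nonempty_machine (Q : UniformQCircuitFamily) : Nonempty (Machine Q) := by
  obtain ⟨C, hCfree, hCunif, hC⟩ :=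
    CoinCWrap.exists_family queryZ_mem_FP answerG_mem_FP Q.isOracleFree Q.isUniform pcA
  obtain ⟨pF, hpF⟩ := QCircuitFamily.IsUniform.isPolySize_holds hCunif
  have hMunif : (PolyCopiesIdx.family ⟨C, pF, fun k => (hpF k).2, X⟩).IsUniform :=
    PolyCopiesIdx.family_isUniform _ hCunif
  obtain ⟨Pout, hPh, hPg, hPF⟩ := CWrap.exists_params hPre_mem_FP (majorityG_mem_FP pF) hMunif
  exact ⟨⟨C, hCfree, hCunif, hC, pF, fun k => (hpF k).2, Pout, hPh, hPg, hPF⟩⟩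

end Construction

/-! ### Layout identities -/

section Layout

variable {n qn mn : ℕ} (S : Fin (K0 n * mn) → (Fin n → ZMod qn) × ZMod qn)

/-- The input of the copies family: `u = ⟨x, ε⟩`, `x = encodeLWESamples S`. [folklore] -/
def uIn : List Bool := boolPair (encodeLWESamples S) []

/-- `|u| = 2|x| + 2`. [folklore] -/
theorem length_uIn : (uIn S).length = 2 * (encodeLWESamples S).length + 2 := by
  rw [uIn, length_boolPair, List.length_nil, add_zero]

namespace Machine

variable {Q : UniformQCircuitFamily} (M : Machine Q)

/-- **The number of copies is `Kc x = 2|x| + 3`.** [folklore] -/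
theorem K_uIn : PolyCopiesIdx.K M.PP (uIn S).length = Kc (encodeLWESamples S) := by
  rw [PolyCopiesIdx.K, Machine.PP, eval_X, length_uIn, Kc]

/-- **The input of copy `j` is the root prefix of the attempt**: `inputIdx u j ++ c = zOf S j c`
(`j < Kc`). [folklore] -/
theorem inputIdx_append (j : ℕ) (hj : j < Kc (encodeLWESamples S)) (c : List Bool) :
    PolyCopiesIdx.inputIdx M.PP (uIn S) j ++ c = zOf S j c := by
  rw [PolyCopiesIdx.inputIdx, K_uIn, ofFn_decide_eq_oneHot hj, uIn, List.append_assoc, boolPair_nil_append, zOf]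

/-- `|inputIdx u j| = nIn |u| = 4|x| + 5`. [folklore] -/
theorem length_inputIdx_uIn (j : ℕ) :
    (PolyCopiesIdx.inputIdx M.PP (uIn S) j).length = 4 * (encodeLWESamples S).length + 5 := by
  rw [PolyCopiesIdx.length_inputIdx, PolyCopiesIdx.nIn, K_uIn, length_uIn, Kc]; ring

/-- **The first wire of copy `j` is the post-processor's offset.** [folklore] -/
theorem blk_uIn (j : ℕ) : PolyCopiesIdx.blk M.PP (uIn S).length j 0 = offPost M.pF S j := by
  rw [PolyCopiesIdx.blk, PolyCopiesIdx.base, PolyCopiesIdx.b, PolyCopiesIdx.nIn, K_uIn, length_uIn, Kc, offPost, basePost, bPost,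
    nInPost, add_zero]
  have e : 2 * (encodeLWESamples S).length + 2 + (2 * (encodeLWESamples S).length + 3) = 4 * (encodeLWESamples S).length + 5 := by ring
  rw [e]
  rfl

/-- The copies `j < K` lie within the output register: `blk j 0 ≤ W`. [folklore] -/
theorem blk_le_W {N j : ℕ} (hj : j < PolyCopiesIdx.K M.PP N) : PolyCopiesIdx.blk M.PP N j 0 ≤ PolyCopiesIdx.W M.PP N :=
  (PolyCopiesIdx.blk_lt_W hj (PolyCopiesIdx.b_pos N)).le

end Machine

end Layout

namespace Machine

variable {Q : UniformQCircuitFamily} (M : Machine Q) {n qn mn : ℕ} [NeZero qn]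
  (S : Fin (K0 n * mn) → (Fin n → ZMod qn) × ZMod qn) (s : Fin n → ZMod qn)

/-! ### Step A: the outer wrap -/

/-- The event "the majority post-processor returns the code of `s`" on the outputs `Y` of the copies
family. [folklore] -/
def majEvent : Set (List Bool) := {Y | majorityG M.pF (boolPair (encodeLWESamples S) Y) = encodeSecret s}

/-- A string with prefix `encodeSecret s` decodes to `s`. [folklore] -/
theorem decodeSecret_of_prefix {z : List Bool} (h : encodeSecret s <+: z) : decodeSecret n qn z = s := by
  obtain ⟨w, rfl⟩ := h
  exact decodeSecret_encodeSecret_append s w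

/-- **Step A.** The success probability of the amplified solver on the samples `S` against `s` is at
least the probability that the copies family, run on `u = ⟨x, ε⟩`, produces an output on which the
majority map returns `encodeSecret s` (classical wrap: `CWrap.kernelProb_family_ge`). [cite: BernsteinVazirani1997, §8 (classical computation inside quantum machines)] -/
theorem majEvent_le_success :
    (M.MID.kernel 0 (uIn S)).toOuterMeasure (M.majEvent S s) ≤ (M.W.searchLWESolver n qn (K0 n * mn) S) s := by
  -- the solver's success event contains the prefix event
  have h1 : (M.W.kernel (encodeLWESamples S)).toOuterMeasure {z | encodeSecret s <+: z} ≤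
      (M.W.searchLWESolver n qn (K0 n * mn) S) s := by
    rw [UniformQCircuitFamily.searchLWESolver, ← PMF.toOuterMeasure_apply_singleton, PMF.toOuterMeasure_map_apply]
    exact PMF.toOuterMeasure_mono _ fun z hz => decodeSecret_of_prefix s hz.1
  refine le_trans ?_ h1
  -- the classical-wrap bound, in `ℝ≥0∞`
  have h2 := CWrap.kernelProb_family_ge M.Pout (encodeLWESamples S) fun _ => M.majEvent S s
  rw [M.hPh, hPre_apply, M.hPg, M.hPF'] at h2
  have h3 : (CWrap.family M.Pout).kernelProb 0 (encodeLWESamples S)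
      {z | ∃ Y ∈ M.majEvent S s, majorityG M.pF (boolPair (encodeLWESamples S) Y) <+: z} ≤
      (CWrap.family M.Pout).kernelProb 0 (encodeLWESamples S) {z | encodeSecret s <+: z} := by
    refine ENNReal.toReal_mono (ne_top_of_le_ne_top ENNReal.one_ne_top ?_) (PMF.toOuterMeasure_mono _ ?_)
    · exact (PMF.toOuterMeasure_mono _ (Set.subset_univ _)).trans_eq ((PMF.toOuterMeasure_apply_eq_one_iff _ _).2 (Set.subset_univ _))
    · rintro z ⟨⟨Y, hY, hz⟩, -⟩
      rw [show majorityG M.pF (boolPair (encodeLWESamples S) Y) = encodeSecret s from hY] at hz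
      exact hz
  have h4 := h2.trans h3
  -- back to outer measures
  have hfin : ∀ (p : PMF (List Bool)) (E : Set (List Bool)), p.toOuterMeasure E ≠ ⊤ := fun p E =>
    ne_top_of_le_ne_top ENNReal.one_ne_top
      ((PMF.toOuterMeasure_mono _ (Set.subset_univ _)).trans_eq ((PMF.toOuterMeasure_apply_eq_one_iff _ _).2 (Set.subset_univ _)))
  exact (ENNReal.toReal_le_toReal (hfin _ _) (hfin _ _)).1 h4

/-! ### Step B: the good event -/

/-- The total number of wires of the copies family on `u`. [folklore] -/
def Wtot : ℕ := PolyCopiesIdx.W M.PP (uIn S).length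

/-- The event that segment `j` of the copies' output has prefix `encodeSecret s`. [folklore] -/
def segGood (Y : List Bool) (j : ℕ) : Prop := encodeSecret s <+: PolyCopiesIdx.segment M.PP (uIn S).length Y j

/-- **The good event**: the output has the right length and more than half of the first `K₀(n)`
segments carry `encodeSecret s`. [folklore] -/
def goodEvent : Set (List Bool) :=
  {Y | Y.length = M.Wtot S ∧ K0 n < 2 * (Finset.univ.filter fun j : Fin (K0 n) => M.segGood S s Y j).card}

omit [NeZero qn] in
/-- `encodeSecret s` is a pair with empty second component. [folklore] -/
theorem encodeSecret_eq_boolPair_fstF (s : Fin n → ZMod qn) : encodeSecret s = boolPair (fstF (encodeSecret s)) [] := by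
  rw [encodeSecret_eq, fstF_boolPair]

omit [NeZero qn] in
/-- **A good segment gives the right candidate.** [folklore] -/
theorem candOf_eq_of_segGood {Y : List Bool} {j : ℕ} (h : M.segGood S s Y j) : candOf M.pF S Y j = encodeSecret s := by
  obtain ⟨r, hr⟩ := h
  rw [candOf, encodeSecret_eq_boolPair_fstF s]
  congr 1
  have e : Y.drop (offPost M.pF S j) = encodeSecret s ++ (r ++ (Y.drop (offPost M.pF S j)).drop
      (PolyCopiesIdx.nIn M.PP (uIn S).length + M.C.ancillas (PolyCopiesIdx.nIn M.PP (uIn S).length))) := by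
    rw [← List.append_assoc, hr, ← M.blk_uIn S j]
    exact (List.take_append_drop _ _).symm
  rw [e, encodeSecret_eq_boolPair_fstF s, boolPair_nil_append, fstF_boolPair, fstF_boolPair]

omit [NeZero qn] in
/-- `K₀(n) ≤ |x|` (`0 < m`), hence `K₀(n) < Kc x` (more copies than attempts). [folklore] -/
theorem K0_lt_Kc (hm : 0 < mn) : K0 n < Kc (encodeLWESamples S) := by
  obtain ⟨-, -, h3⟩ := le_length_encodeLWESamples (Nat.mul_pos (K0_pos n) hm) S
  have : K0 n ≤ K0 n * mn := Nat.le_mul_of_pos_right _ hm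
  unfold Kc; omega

omit [NeZero qn] in
/-- **Step B.** The good event implies the majority event. [cite: AroraBarak2009, §7.4.1 (majority)] -/
theorem goodEvent_subset_majEvent (hm : 0 < mn) : M.goodEvent S s ⊆ M.majEvent S s := by
  rintro Y ⟨hlen, hmaj⟩
  have hoff : ∀ j, j < K0 n → offPost M.pF S j ≤ Y.length := fun j hj => by
    rw [← M.blk_uIn S j, hlen]
    exact M.blk_le_W (hj.trans (by rw [M.K_uIn S]; exact K0_lt_Kc S hm))
  refine majorityG_eq_of_majority M.pF S Y hm hoff s (hmaj.trans_le ?_)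
  refine Nat.mul_le_mul_left 2 (Finset.card_le_card fun j hj => ?_)
  rw [Finset.mem_filter] at hj ⊢
  exact ⟨hj.1, M.candOf_eq_of_segGood S s hj.2⟩

/-! ### Step C: the failure bound from independence -/

/-- The number of copies. [folklore] -/
def Kcop : ℕ := PolyCopiesIdx.K M.PP (uIn S).length

/-- The attempts among the copies: the first `K₀(n)`. [folklore] -/
def attempts : Finset (Fin (M.Kcop S)) := Finset.univ.filter fun j => (j : ℕ) < K0 n

/-- The bad segments: those without the prefix `encodeSecret s`. [folklore] -/
def badSeg : Set (List Bool) := {seg | ¬ encodeSecret s <+: seg}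

/-- The per-copy badness probability. [folklore] -/
def φ (j : Fin (M.Kcop S)) : ℝ≥0∞ := (PolyCopiesIdx.blockLaw M.PP (uIn S) j).toOuterMeasure (badSeg s)

omit [NeZero qn] in
/-- `|attempts| = K₀(n)` (`0 < m`). [folklore] -/
theorem card_attempts (hm : 0 < mn) : (M.attempts S).card = K0 n := by
  have hK : K0 n ≤ M.Kcop S := by
    rw [Kcop, M.K_uIn S]; exact (K0_lt_Kc S hm).le
  rw [attempts]
  have e : (Finset.univ.filter fun j : Fin (M.Kcop S) => (j : ℕ) < K0 n) =
      (Finset.univ : Finset (Fin (K0 n))).map (Fin.castLEEmb hK) := by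
    ext j
    simp only [Finset.mem_filter, Finset.mem_univ, true_and, Finset.mem_map, Fin.castLEEmb_apply]
    constructor
    · intro hj; exact ⟨⟨j, hj⟩, Fin.ext rfl⟩
    · rintro ⟨i, rfl⟩; exact i.isLt
  rw [e, Finset.card_map, Finset.card_univ, Fintype.card_fin]

/-- The outputs of a family on `x` have length `|x| + ancillas |x|`. [folklore] -/
theorem _root_.Literature.Computability.Cryptography.QCircuitFamily.length_of_mem_support_kernel
    (F : QCircuitFamily cliffordT) (A : Language Bool) (x : List Bool) {y : List Bool} (hy : y ∈ (F.kernel A x).support) :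
    y.length = x.length + F.ancillas x.length := by
  obtain ⟨z, -, rfl⟩ := (PMF.mem_support_map_iff _ _ _).1 hy
  exact List.length_ofFn

omit [NeZero qn] in
/-- The outputs of the copies family have length `W`. [folklore] -/
theorem length_of_mem_support {Y : List Bool} (hY : Y ∈ (M.MID.kernel 0 (uIn S)).support) : Y.length = M.Wtot S := by
  rw [M.MID.length_of_mem_support_kernel 0 (uIn S) hY]
  exact PolyCopiesIdx.n_add_anc (P := M.PP) (uIn S).length

/-- **The law of the segments** (`PolyCopiesIdx.kernel_map_segments`), as an identity of event
probabilities. [cite: NielsenChuang2010, §2.2.8 (measurement statistics of a product state)] -/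
theorem toOuterMeasure_segments_preimage (P : PolyCopies.Params) (x : List Bool)
    (E : Set (Fin (PolyCopiesIdx.K P x.length) → List Bool)) :
    ((PolyCopiesIdx.family P).kernel 0 x).toOuterMeasure
        ((fun w => fun j : Fin (PolyCopiesIdx.K P x.length) => PolyCopiesIdx.segment P x.length w j) ⁻¹' E) =
      (indepLaw (PolyCopiesIdx.K P x.length) fun j => PolyCopiesIdx.blockLaw P x j).toOuterMeasure E := by
  rw [← PMF.toOuterMeasure_map_apply, PolyCopiesIdx.kernel_map_segments]

omit [NeZero qn] in
/-- Good attempts plus bad attempts are all the attempts. [folklore] -/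
theorem card_good_add_bad (hm : 0 < mn) (Y : List Bool) :
    (Finset.univ.filter fun j : Fin (K0 n) => M.segGood S s Y j).card +
      badCountOn (M.attempts S) (fun _ => badSeg s)
        (fun j : Fin (M.Kcop S) => PolyCopiesIdx.segment M.PP (uIn S).length Y j) = K0 n := by
  have hK : K0 n ≤ M.Kcop S := by rw [Kcop, M.K_uIn S]; exact (K0_lt_Kc S hm).le
  have e1 : (Finset.univ.filter fun j : Fin (K0 n) => M.segGood S s Y j).card =
      ((M.attempts S).filter fun j : Fin (M.Kcop S) => ¬ PolyCopiesIdx.segment M.PP (uIn S).length Y j ∈ badSeg s).card := by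
    refine Finset.card_bij (fun j _ => Fin.castLE hK j) (fun j hj => ?_)
      (fun a _ b _ h => Fin.ext (by simpa using congrArg Fin.val h)) (fun j hj => ?_)
    · rw [Finset.mem_filter] at hj ⊢
      refine ⟨Finset.mem_filter.2 ⟨Finset.mem_univ _, j.isLt⟩, ?_⟩
      simpa [badSeg, segGood] using hj.2
    · rw [Finset.mem_filter] at hj
      obtain ⟨hj1, hj2⟩ := hj
      rw [attempts, Finset.mem_filter] at hj1
      refine ⟨⟨j, hj1.2⟩, Finset.mem_filter.2 ⟨Finset.mem_univ _, ?_⟩, Fin.ext rfl⟩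
      simpa [badSeg, segGood] using hj2
  rw [e1, badCountOn, add_comm, Finset.card_filter_add_card_filter_not, M.card_attempts S hm]

omit [NeZero qn] in
/-- **Step C.** The complement of the good event has probability at most
`∏_{j < K₀} (1 + φⱼ) / (√2)^{K₀}` (independent segments, `PolyCopiesIdx.kernel_map_segments`, and
majority amplification on the sub-population of the attempts). [cite: AroraBarak2009, §7.4.1 (proof of Thm 7.10)] -/
theorem goodEvent_compl_le (hm : 0 < mn) :
    (M.MID.kernel 0 (uIn S)).toOuterMeasure (M.goodEvent S s)ᶜ ≤
      (∏ j ∈ M.attempts S, (1 + M.φ S s j)) / ((NNReal.sqrt 2 : NNReal) : ℝ≥0∞) ^ K0 n := by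
  -- on the support, not good ⇒ at least half of the attempts are bad
  have hsub : (M.goodEvent S s)ᶜ ∩ (M.MID.kernel 0 (uIn S)).support ⊆
      (fun w => fun j : Fin (M.Kcop S) => PolyCopiesIdx.segment M.PP (uIn S).length w j) ⁻¹'
        {v | (M.attempts S).card ≤ 2 * badCountOn (M.attempts S) (fun _ => badSeg s) v} := by
    rintro Y ⟨hY, hsupp⟩
    have hlen := M.length_of_mem_support S hsupp
    have hnot : ¬ K0 n < 2 * (Finset.univ.filter fun j : Fin (K0 n) => M.segGood S s Y j).card := fun h => hY ⟨hlen, h⟩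
    have hsplit := M.card_good_add_bad S s hm Y
    change (M.attempts S).card ≤ 2 * badCountOn (M.attempts S) (fun _ => badSeg s)
      (fun j : Fin (M.Kcop S) => PolyCopiesIdx.segment M.PP (uIn S).length Y j)
    rw [M.card_attempts S hm]
    omega
  calc (M.MID.kernel 0 (uIn S)).toOuterMeasure (M.goodEvent S s)ᶜ
      ≤ (M.MID.kernel 0 (uIn S)).toOuterMeasure
          ((fun w => fun j : Fin (M.Kcop S) => PolyCopiesIdx.segment M.PP (uIn S).length w j) ⁻¹'
            {v | (M.attempts S).card ≤ 2 * badCountOn (M.attempts S) (fun _ => badSeg s) v}) :=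
        PMF.toOuterMeasure_mono _ hsub
    _ = (indepLaw (M.Kcop S) fun j => PolyCopiesIdx.blockLaw M.PP (uIn S) j).toOuterMeasure
          {v | (M.attempts S).card ≤ 2 * badCountOn (M.attempts S) (fun _ => badSeg s) v} :=
        toOuterMeasure_segments_preimage M.PP (uIn S) _
    _ ≤ (∏ j ∈ M.attempts S, (1 + M.φ S s j)) / ((NNReal.sqrt 2 : NNReal) : ℝ≥0∞) ^ (M.attempts S).card :=
        indepLaw_toOuterMeasure_half_le_finset _ _ (fun _ => badSeg s) (M.φ S s) fun j _ => le_rfl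
    _ = _ := by rw [M.card_attempts S hm]

end Machine

/-- A probability is at most `1`. [folklore] -/
theorem prob_le_one {α : Type} (p : PMF α) (E : Set α) : p.toOuterMeasure E ≤ 1 := by
  rw [← (p.toOuterMeasure_apply_eq_one_iff Set.univ).2 (Set.subset_univ _)]
  exact p.toOuterMeasure_mono (Set.subset_univ _)

/-- A probability is finite. [folklore] -/
theorem prob_ne_top {α : Type} (p : PMF α) (E : Set α) : p.toOuterMeasure E ≠ ⊤ :=
  ne_top_of_le_ne_top ENNReal.one_ne_top (prob_le_one p E)

/-- A `tsum` over a finite type is a finite sum. [folklore] -/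
theorem tsum_univ {β : Type} [Fintype β] (f : β → ℝ≥0∞) : ∑' b, f b = ∑ b, f b :=
  tsum_eq_sum fun b hb => absurd (Finset.mem_univ b) hb

namespace Machine

variable {Q : UniformQCircuitFamily} (M : Machine Q) {n qn mn : ℕ} [NeZero qn]
  (S : Fin (K0 n * mn) → (Fin n → ZMod qn) × ZMod qn) (s : Fin n → ZMod qn)

/-! ### Step D: the attempt family, coin by coin -/

/-- The number of coins the shift reads: `L = Kw · n`. [folklore] -/
def L (n qn : ℕ) : ℕ := Kw n qn * n

/-- **The value of one attempt on the block `B` with coins `c`**: the probability that the given solver,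
run on `B` shifted by `t = shiftOfCoins c`, answers `s + t` (a real number in `[0,1]`).
[cite: Regev2009, §4 Lemma 4.1 (proof)] -/
def blockVal (Q : UniformQCircuitFamily) (s : Fin n → ZMod qn) (B : Fin mn → (Fin n → ZMod qn) × ZMod qn)
    (c : QReg (L n qn)) : ℝ :=
  ((Q.searchLWESolver n qn mn (shiftSample (shiftOfCoins n qn (List.ofFn c)) ∘ B))
    (s + shiftOfCoins n qn (List.ofFn c))).toReal

omit [NeZero qn] in
/-- `0 ≤ blockVal ≤ 1`. [folklore] -/
theorem blockVal_nonneg (B : Fin mn → (Fin n → ZMod qn) × ZMod qn) (c : QReg (L n qn)) : 0 ≤ blockVal Q s B c :=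
  ENNReal.toReal_nonneg

omit [NeZero qn] in
/-- `blockVal ≤ 1`. [folklore] -/
theorem blockVal_le_one (B : Fin mn → (Fin n → ZMod qn) × ZMod qn) (c : QReg (L n qn)) : blockVal Q s B c ≤ 1 :=
  ENNReal.toReal_le_of_le_ofReal zero_le_one (by rw [ENNReal.ofReal_one]; exact PMF.coe_le_one _ _)

/-- **The per-block factor** `ψ(B) = 2 − 2^{-L} Σ_c blockVal B c ∈ [1, 2]`. [folklore] -/
def ψR (Q : UniformQCircuitFamily) (s : Fin n → ZMod qn) (B : Fin mn → (Fin n → ZMod qn) × ZMod qn) : ℝ :=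
  2 - (1 / 2 : ℝ) ^ L n qn * ∑ c : QReg (L n qn), blockVal Q s B c

omit [NeZero qn] in
/-- The coin average is in `[0, 1]`: lower bound. [folklore] -/
theorem avg_blockVal_nonneg (B : Fin mn → (Fin n → ZMod qn) × ZMod qn) :
    0 ≤ (1 / 2 : ℝ) ^ L n qn * ∑ c : QReg (L n qn), blockVal Q s B c :=
  mul_nonneg (by positivity) (Finset.sum_nonneg fun c _ => blockVal_nonneg s B c)

omit [NeZero qn] in
/-- The coin average is in `[0, 1]`: upper bound. [folklore] -/
theorem avg_blockVal_le_one (B : Fin mn → (Fin n → ZMod qn) × ZMod qn) :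
    (1 / 2 : ℝ) ^ L n qn * ∑ c : QReg (L n qn), blockVal Q s B c ≤ 1 := by
  have h : ∑ c : QReg (L n qn), blockVal Q s B c ≤ ∑ _c : QReg (L n qn), (1 : ℝ) :=
    Finset.sum_le_sum fun c _ => blockVal_le_one s B c
  rw [Finset.sum_const, Finset.card_univ, Fintype.card_fun, Fintype.card_bool, Fintype.card_fin, nsmul_eq_mul, mul_one] at h
  calc (1 / 2 : ℝ) ^ L n qn * ∑ c : QReg (L n qn), blockVal Q s B c ≤ (1 / 2 : ℝ) ^ L n qn * (2 : ℝ) ^ L n qn := by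
        gcongr; exact_mod_cast h
    _ = 1 := by rw [← mul_pow]; norm_num

omit [NeZero qn] in
/-- `1 ≤ ψ`. [folklore] -/
theorem one_le_ψR (B : Fin mn → (Fin n → ZMod qn) × ZMod qn) : 1 ≤ ψR Q s B := by
  have := avg_blockVal_le_one (Q := Q) s B; unfold ψR; linarith

omit [NeZero qn] in
/-- `0 ≤ ψ`. [folklore] -/
theorem ψR_nonneg (B : Fin mn → (Fin n → ZMod qn) × ZMod qn) : 0 ≤ ψR Q s B := le_trans zero_le_one (one_le_ψR s B)

omit [NeZero qn] in
/-- The success probability of the given solver on samples `S'` against `s'`, as the kernel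
probability of a decoding event. [folklore] -/
theorem kernelProb_decode_eq (S' : Fin mn → (Fin n → ZMod qn) × ZMod qn) (s' : Fin n → ZMod qn) :
    Q.family.kernelProb 0 (encodeLWESamples S') {y | decodeSecret n qn y = s'} = ((Q.searchLWESolver n qn mn S') s').toReal := by
  change Q.kernelProb (encodeLWESamples S') {y | decodeSecret n qn y = s'} = _
  rw [UniformQCircuitFamily.kernelProb_eq, UniformQCircuitFamily.searchLWESolver, ← PMF.toOuterMeasure_apply_singleton,
    PMF.toOuterMeasure_map_apply]
  rfl

omit [NeZero qn] in
/-- Enough coins: `n |bin q| ≤ 2 (4|x| + 5)²` (`0 < m`). [folklore] -/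
theorem coins_enough (hm : 0 < mn) (j : ℕ) :
    n * (encodeNat qn).length ≤ pcA.eval (PolyCopiesIdx.inputIdx M.PP (uIn S) j).length ∧
      L n qn ≤ pcA.eval (PolyCopiesIdx.inputIdx M.PP (uIn S) j).length := by
  obtain ⟨h1, h2, -⟩ := le_length_encodeLWESamples (Nat.mul_pos (K0_pos n) hm) S
  rw [M.length_inputIdx_uIn S, eval_pcA, L, Kw]
  constructor <;> nlinarith

/-- **Step D + prefix averaging.** For an attempt `j`, `1 + φⱼ ≤ ψ(batch j)`: the badness of segment `j`
is one minus the probability that the attempt family writes `encodeSecret s`, which by the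
coin-averaged classical-wrap bound (`Machine.hC`) is at least the average over the coins of the
probability that the given solver answers `s + t` on batch `j` shifted by `t` — and that average only
reads the first `L` coins. [cite: Regev2009, §4 Lemma 4.1 (proof)] -/
theorem one_add_φ_le (hm : 0 < mn) (j : Fin (M.Kcop S)) (hj0 : (j : ℕ) < K0 n) :
    1 + M.φ S s j ≤ ENNReal.ofReal (ψR Q s (batchOf S ⟨j, hj0⟩)) := by
  have hjc : (j : ℕ) < Kc (encodeLWESamples S) := hj0.trans (K0_lt_Kc S hm)
  obtain ⟨hc, hLk⟩ := M.coins_enough S hm j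
  set v := PolyCopiesIdx.inputIdx M.PP (uIn S) j with hv
  set k := pcA.eval v.length with hk
  -- the prefix event and its probability under the attempt family
  set Pref : Set (List Bool) := {z | encodeSecret s <+: z} with hPref
  have hφ : M.φ S s j = 1 - (M.C.kernel 0 v).toOuterMeasure Pref := by
    rw [φ, PolyCopiesIdx.blockLaw_eq_kernel]
    refine ENNReal.eq_sub_of_add_eq (prob_ne_top _ _) ?_
    rw [add_comm]; exact toOuterMeasure_add_compl _ Pref
  -- the coin-averaged bound of the attempt family
  have hC := M.hC v fun c => {y | decodeSecret n qn y = s + shiftOfCoins n qn (List.ofFn c)}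
  have hsub : {z | ∃ c : QReg k, ∃ y ∈ {y | decodeSecret n qn y = s + shiftOfCoins n qn (List.ofFn c)},
      answerG (boolPair (v ++ List.ofFn c) y) <+: z} ⊆ Pref := by
    rintro z ⟨c, y, hy, hz⟩
    rw [hv, M.inputIdx_append S j hjc,
      show answerG (boolPair (zOf S j (List.ofFn c)) y) = encodeSecret s from answerG_apply_of_decode hm hjc hy] at hz
    exact hz
  have hC' : (1 / 2 : ℝ) ^ k * ∑ c : QReg k, Q.family.kernelProb 0 (queryZ (v ++ List.ofFn c))
      {y | decodeSecret n qn y = s + shiftOfCoins n qn (List.ofFn c)} ≤ ((M.C.kernel 0 v).toOuterMeasure Pref).toReal := by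
    refine hC.trans (ENNReal.toReal_mono (prob_ne_top _ _) ?_)
    exact PMF.toOuterMeasure_mono _ fun z hz => hsub hz.1
  -- the terms of the sum: the given solver on batch `j` shifted by the coins
  set g : List Bool → ℝ := fun r =>
    ((Q.searchLWESolver n qn mn (shiftSample (shiftOfCoins n qn r) ∘ batchOf S ⟨j, hj0⟩)) (s + shiftOfCoins n qn r)).toReal
    with hg
  have hterm : ∀ c : QReg k, Q.family.kernelProb 0 (queryZ (v ++ List.ofFn c))
      {y | decodeSecret n qn y = s + shiftOfCoins n qn (List.ofFn c)} = g (List.ofFn c) := by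
    intro c
    rw [hv, M.inputIdx_append S j hjc, queryZ_zOf hm hj0 (by rw [List.length_ofFn]; exact hc), kernelProb_decode_eq]
    rfl
  -- the sum only reads the first `L` coins
  have hgtake : ∀ r : List Bool, g (r.take (L n qn)) = g r := fun r => by
    simp only [hg, L, shiftOfCoins_take]
  obtain ⟨r, hr⟩ := Nat.exists_eq_add_of_le hLk
  have hsum : (1 / 2 : ℝ) ^ k * ∑ c : QReg k, g (List.ofFn c) = (1 / 2 : ℝ) ^ L n qn * ∑ c : QReg (L n qn), g (List.ofFn c) := by
    have e1 : ∑ c : QReg k, g (List.ofFn c) = ∑ c : QReg (L n qn + r), g ((List.ofFn c).take (L n qn)) := by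
      rw [← Fintype.sum_equiv (castRegEquiv hr) _ _ (fun c => rfl)]
      refine Finset.sum_congr rfl fun c _ => ?_
      rw [castRegEquiv_apply, ofFn_castReg, hgtake]
    rw [e1, sum_qreg_take_eq, hr, pow_add, nsmul_eq_mul]
    push_cast
    have h2 : (1 / 2 : ℝ) ^ r * 2 ^ r = 1 := by rw [← mul_pow]; norm_num
    calc (1 / 2 : ℝ) ^ L n qn * (1 / 2) ^ r * (2 ^ r * ∑ c : QReg (L n qn), g (List.ofFn c))
        = (1 / 2 : ℝ) ^ L n qn * ((1 / 2) ^ r * 2 ^ r) * ∑ c : QReg (L n qn), g (List.ofFn c) := by ring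
      _ = _ := by rw [h2, mul_one]
  have havg : (1 / 2 : ℝ) ^ L n qn * ∑ c : QReg (L n qn), blockVal Q s (batchOf S ⟨j, hj0⟩) c ≤
      ((M.C.kernel 0 v).toOuterMeasure Pref).toReal := by
    have e : ∑ c : QReg (L n qn), blockVal Q s (batchOf S ⟨j, hj0⟩) c = ∑ c : QReg (L n qn), g (List.ofFn c) := rfl
    rw [e, ← hsum]
    refine le_trans (le_of_eq ?_) hC'
    exact congrArg _ (Finset.sum_congr rfl fun c _ => (hterm c).symm)
  -- assemble: `1 + φ = 2 − P(Pref) ≤ 2 − avg = ψ`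
  have hPtop : (M.C.kernel 0 v).toOuterMeasure Pref ≠ ⊤ := prob_ne_top _ _
  have hP1 : (M.C.kernel 0 v).toOuterMeasure Pref ≤ 1 := prob_le_one _ _
  rw [hφ, ψR, ENNReal.ofReal_sub _ (avg_blockVal_nonneg s _), show ENNReal.ofReal 2 = 2 by norm_num]
  have hle : ENNReal.ofReal ((1 / 2 : ℝ) ^ L n qn * ∑ c : QReg (L n qn), blockVal Q s (batchOf S ⟨j, hj0⟩) c) ≤
      (M.C.kernel 0 v).toOuterMeasure Pref := (ENNReal.ofReal_le_iff_le_toReal hPtop).2 havg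
  calc 1 + (1 - (M.C.kernel 0 v).toOuterMeasure Pref) = 2 - (M.C.kernel 0 v).toOuterMeasure Pref := by
        rw [add_comm, ENNReal.sub_add_eq_add_sub hP1 hPtop, one_add_one_eq_two]
    _ ≤ 2 - ENNReal.ofReal ((1 / 2 : ℝ) ^ L n qn * ∑ c : QReg (L n qn), blockVal Q s (batchOf S ⟨j, hj0⟩) c) :=
        tsub_le_tsub_left hle 2

/-! ### Steps C + D: the failure bound on the samples `S` -/

omit [NeZero qn] in
/-- The attempts as the image of `Fin K₀`. [folklore] -/
theorem attempts_eq_map (hm : 0 < mn) :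
    M.attempts S = (Finset.univ : Finset (Fin (K0 n))).map
      (Fin.castLEEmb (show K0 n ≤ M.Kcop S by rw [Kcop, M.K_uIn S]; exact (K0_lt_Kc S hm).le)) := by
  ext j
  simp only [attempts, Finset.mem_filter, Finset.mem_univ, true_and, Finset.mem_map, Fin.castLEEmb_apply]
  exact ⟨fun hj => ⟨⟨j, hj⟩, Fin.ext rfl⟩, fun ⟨i, hi⟩ => hi ▸ i.isLt⟩

/-- **The failure bound on the samples `S`**: the good event fails with probability at most
`ofReal (∏_{j<K₀} ψ(batch j)) / (√2)^{K₀}`. [cite: AroraBarak2009, §7.4.1; Regev2009 §4 Lemma 4.1 (proof)] -/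
theorem fail_le (hm : 0 < mn) :
    (M.MID.kernel 0 (uIn S)).toOuterMeasure (M.goodEvent S s)ᶜ ≤
      ENNReal.ofReal (∏ i : Fin (K0 n), ψR Q s (batchOf S i)) / ((NNReal.sqrt 2 : NNReal) : ℝ≥0∞) ^ K0 n := by
  refine (M.goodEvent_compl_le S s hm).trans ?_
  gcongr
  -- termwise on the attempts
  set G : Fin (M.Kcop S) → ℝ≥0∞ := fun j => if h : (j : ℕ) < K0 n then ENNReal.ofReal (ψR Q s (batchOf S ⟨j, h⟩)) else 1 with hG
  have h1 : ∏ j ∈ M.attempts S, (1 + M.φ S s j) ≤ ∏ j ∈ M.attempts S, G j := by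
    refine Finset.prod_le_prod' fun j hj => ?_
    have hj0 : (j : ℕ) < K0 n := by rw [attempts, Finset.mem_filter] at hj; exact hj.2
    rw [hG]; dsimp only; rw [dif_pos hj0]
    exact M.one_add_φ_le S s hm j hj0
  refine h1.trans (le_of_eq ?_)
  rw [M.attempts_eq_map S hm, Finset.prod_map, ENNReal.ofReal_prod_of_nonneg fun i _ => ψR_nonneg s _]
  refine Finset.prod_congr rfl fun i _ => ?_
  rw [hG]; dsimp only
  rw [dif_pos (by exact i.isLt)]
  rfl

/-! ### Step E: the expectation over the samples -/

/-- **Expectation of the per-block factor**: `E_B[ofReal ψ(B)] = ofReal (2 − 2^{-L} Σ_c Pr[solver answers s + t_c against s + t_c])`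
(Regev's self-reduction in the secret, `searchSuccessProbOf_shift`). [cite: Regev2009, §4 Lemma 4.1 (proof)] -/
theorem tsum_ψR_eq (χ : PMF (ZMod qn)) :
    ∑' B, lweSamples χ s mn B * ENNReal.ofReal (ψR Q s B) =
      ENNReal.ofReal (2 - (1 / 2 : ℝ) ^ L n qn * ∑ c : QReg (L n qn),
        (searchSuccessProbOf χ mn (Q.searchLWESolver n qn mn) (s + shiftOfCoins n qn (List.ofFn c))).toReal) := by
  rw [tsum_univ]
  -- each term as `ofReal` of a real
  have e1 : ∀ B, lweSamples χ s mn B * ENNReal.ofReal (ψR Q s B) = ENNReal.ofReal ((lweSamples χ s mn B).toReal * ψR Q s B) := fun B => by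
    rw [ENNReal.ofReal_mul ENNReal.toReal_nonneg, ENNReal.ofReal_toReal (PMF.apply_ne_top _ _)]
  simp_rw [e1]
  rw [← ENNReal.ofReal_sum_of_nonneg fun B _ => mul_nonneg ENNReal.toReal_nonneg (ψR_nonneg s B)]
  congr 1
  -- linearity
  have hP1 : ∑ B, (lweSamples χ s mn B).toReal = 1 := by
    rw [← ENNReal.toReal_sum fun B _ => PMF.apply_ne_top _ _, ← tsum_univ, PMF.tsum_coe, ENNReal.toReal_one]
  have hshift : ∀ c : QReg (L n qn), ∑ B, (lweSamples χ s mn B).toReal * blockVal Q s B c =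
      (searchSuccessProbOf χ mn (Q.searchLWESolver n qn mn) (s + shiftOfCoins n qn (List.ofFn c))).toReal := by
    intro c
    rw [← searchSuccessProbOf_shift χ mn (Q.searchLWESolver n qn mn) s (shiftOfCoins n qn (List.ofFn c)), PMF.bind_apply, tsum_univ,
      ENNReal.toReal_sum fun B _ => ENNReal.mul_ne_top (PMF.apply_ne_top _ _) (PMF.apply_ne_top _ _)]
    refine Finset.sum_congr rfl fun B _ => ?_
    rw [ENNReal.toReal_mul]
    rfl
  simp only [ψR, mul_sub, Finset.sum_sub_distrib, ← Finset.sum_mul, hP1, one_mul, Finset.mul_sum]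
  congr 1
  rw [Finset.sum_comm]
  refine Finset.sum_congr rfl fun c _ => ?_
  rw [← hshift c, Finset.mul_sum]
  refine Finset.sum_congr rfl fun B _ => ?_
  ring

/-- **The per-block expectation is at most `4/3 + n/2ⁿ`** when the given solver has average-case
success `≥ 2/3`: the coins give a near-uniform shift (`avg_shiftOfCoins_le`), and over a uniform shift
the success probability against `s + t` is the average-case success probability
(`avg_searchSuccessProbOf_add`). [cite: Regev2009, §4 Lemma 4.1 (proof)] -/
theorem tsum_ψR_le (χ : PMF (ZMod qn)) (hA : ENNReal.ofReal (2 / 3) ≤ searchSuccessProb χ mn (Q.searchLWESolver n qn mn)) :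
    ∑' B, lweSamples χ s mn B * ENNReal.ofReal (ψR Q s B) ≤ ENNReal.ofReal (4 / 3 + n / 2 ^ n) := by
  rw [tsum_ψR_eq]
  refine ENNReal.ofReal_le_ofReal ?_
  set succ : (Fin n → ZMod qn) → ℝ := fun t => (searchSuccessProbOf χ mn (Q.searchLWESolver n qn mn) (s + t)).toReal with hsucc
  have hs0 : ∀ t, 0 ≤ succ t := fun t => ENNReal.toReal_nonneg
  have hs1 : ∀ t, succ t ≤ 1 := fun t => ENNReal.toReal_le_of_le_ofReal zero_le_one (by rw [ENNReal.ofReal_one]; exact PMF.coe_le_one _ _)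
  -- near-uniformity of the shift, applied to the failure statistic `1 − succ`
  have hdom := avg_shiftOfCoins_le (fun t => 1 - succ t) (fun t => by linarith [hs1 t]) (fun t => by linarith [hs0 t])
  -- the uniform average is the average-case success probability
  have havg : ∑ t : Fin n → ZMod qn, succ t = (qn : ℝ) ^ n * (searchSuccessProb χ mn (Q.searchLWESolver n qn mn)).toReal := by
    rw [← avg_searchSuccessProbOf_add χ mn _ s,
      ENNReal.toReal_sum fun t _ => ENNReal.mul_ne_top (PMF.apply_ne_top _ _)
        (ne_top_of_le_ne_top ENNReal.one_ne_top (searchSuccessProbOf_le_one χ mn _ _)),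
      Finset.mul_sum]
    refine Finset.sum_congr rfl fun t _ => ?_
    rw [ENNReal.toReal_mul, PMF.uniformOfFintype_apply, ENNReal.toReal_inv, ENNReal.toReal_natCast, Fintype.card_fun, Fintype.card_fin,
      ZMod.card, Nat.cast_pow, hsucc]
    have hq : (qn : ℝ) ^ n ≠ 0 := pow_ne_zero _ (Nat.cast_ne_zero.2 (NeZero.ne qn))
    field_simp
  have hA' : 2 / 3 ≤ (searchSuccessProb χ mn (Q.searchLWESolver n qn mn)).toReal :=
    (ENNReal.ofReal_le_iff_le_toReal (ne_top_of_le_ne_top ENNReal.one_ne_top (searchSuccessProb_le_one_holds χ mn _))).1 hA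
  have hq0 : (0 : ℝ) < (qn : ℝ) ^ n := pow_pos (Nat.cast_pos.2 (Nat.pos_of_ne_zero (NeZero.ne qn))) n
  have h2L : (0 : ℝ) < 2 ^ L n qn := by positivity
  -- rewrite the two sides of the domination estimate
  have lhs : (∑ c : Fin (Kw n qn * n) → Bool, (1 - succ (shiftOfCoins n qn (List.ofFn c)))) / 2 ^ (Kw n qn * n) =
      1 - (1 / 2 : ℝ) ^ L n qn * ∑ c : QReg (L n qn), succ (shiftOfCoins n qn (List.ofFn c)) := by
    rw [Finset.sum_sub_distrib, Finset.sum_const, Finset.card_univ, Fintype.card_fun, Fintype.card_bool, Fintype.card_fin, nsmul_eq_mul,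
      mul_one, L]
    push_cast
    have h2 : (2 : ℝ) ^ (Kw n qn * n) ≠ 0 := by positivity
    rw [one_div_pow]
    field_simp
  have rhs : (∑ t : Fin n → ZMod qn, (1 - succ t)) / (qn : ℝ) ^ n = 1 - (searchSuccessProb χ mn (Q.searchLWESolver n qn mn)).toReal := by
    rw [Finset.sum_sub_distrib, Finset.sum_const, Finset.card_univ, Fintype.card_fun, Fintype.card_fin, ZMod.card, nsmul_eq_mul, mul_one,
      havg, sub_div, Nat.cast_pow, div_self (ne_of_gt hq0), mul_div_cancel_left₀ _ (ne_of_gt hq0)]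
  rw [lhs, rhs] at hdom
  have herr := mul_div_two_pow_Kw_le n qn
  have : (1 / 2 : ℝ) ^ L n qn * ∑ c : QReg (L n qn), succ (shiftOfCoins n qn (List.ofFn c)) ≥ 2 / 3 - n / 2 ^ n := by linarith
  linarith

/-- **Step E.** The expected failure bound:
`E_S[fail bound(S)] = (E_B[ofReal ψ(B)])^{K₀} / (√2)^{K₀}` (independent blocks,
`tsum_iidPMF_mul_prod_blocksOf`). [cite: AroraBarak2009, §A.2 (independence); Regev2009 §2 (m independent samples)] -/
theorem tsum_fail_eq (χ : PMF (ZMod qn)) :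
    ∑' S, lweSamples χ s (K0 n * mn) S *
        (ENNReal.ofReal (∏ i : Fin (K0 n), ψR Q s (batchOf S i)) / ((NNReal.sqrt 2 : NNReal) : ℝ≥0∞) ^ K0 n) =
      (∑' B, lweSamples χ s mn B * ENNReal.ofReal (ψR Q s B)) ^ K0 n / ((NNReal.sqrt 2 : NNReal) : ℝ≥0∞) ^ K0 n := by
  simp_rw [div_eq_mul_inv, ← mul_assoc]
  rw [ENNReal.tsum_mul_right]
  congr 1
  simp_rw [ENNReal.ofReal_prod_of_nonneg fun i _ => ψR_nonneg (Q := Q) s _]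
  show ∑' S', iidPMF (lweSample χ s) (K0 n * mn) S' * ∏ j, ENNReal.ofReal (ψR Q s (blocksOf (K0 n) mn S' j)) = _
  rw [tsum_iidPMF_mul_prod_blocksOf (lweSample χ s) (K0 n) mn fun _ B => ENNReal.ofReal (ψR Q s B), Finset.prod_const, Finset.card_univ,
    Fintype.card_fin]
  rfl

/-! ### Step F: the numbers -/

/-- `1024 n ≤ 10 · 2ⁿ` for `n ≥ 10`. [folklore] -/
theorem nat_bound {n : ℕ} (h : 10 ≤ n) : 1024 * n ≤ 10 * 2 ^ n := by
  induction n, h using Nat.le_induction with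
  | base => norm_num
  | succ k hk ih =>
    have h2 : 2 ^ 10 ≤ 2 ^ k := Nat.pow_le_pow_right (by norm_num) hk
    rw [pow_succ]
    omega

/-- `n / 2ⁿ ≤ 10/1024` for `n ≥ 10`. [folklore] -/
theorem real_bound {n : ℕ} (h : 10 ≤ n) : (n : ℝ) / 2 ^ n ≤ 10 / 1024 := by
  rw [div_le_div_iff₀ (by positivity) (by norm_num)]
  have := (Nat.cast_le (α := ℝ)).2 (nat_bound h)
  push_cast at this
  linarith

/-- **The final number**: `(13431/10000)^{18(n+1)} / (√2)^{18(n+1)} ≤ (1/2)^{n+1}`. [folklore] -/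
theorem final_bound (n : ℕ) :
    ENNReal.ofReal (13431 / 10000) ^ K0 n / ((NNReal.sqrt 2 : NNReal) : ℝ≥0∞) ^ K0 n ≤ ENNReal.ofReal ((1 / 2 : ℝ) ^ (n + 1)) := by
  have hK : K0 n = 2 * (9 * (n + 1)) := by unfold K0; ring
  rw [hK, sqrt_two_pow_two_mul, ← ENNReal.ofReal_pow (by norm_num), show (2 : ℝ≥0∞) ^ (9 * (n + 1)) = ENNReal.ofReal (2 ^ (9 * (n + 1))) by
    rw [ENNReal.ofReal_pow (by norm_num)]; norm_num, ← ENNReal.ofReal_div_of_pos (by positivity)]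
  refine ENNReal.ofReal_le_ofReal ?_
  have e : (13431 / 10000 : ℝ) ^ (2 * (9 * (n + 1))) / 2 ^ (9 * (n + 1)) = (((13431 / 10000 : ℝ) ^ 2 / 2) ^ 9) ^ (n + 1) := by
    conv_rhs => rw [← pow_mul, div_pow, ← pow_mul]
  rw [e]
  exact pow_le_pow_left₀ (by positivity) (by norm_num) _

/-! ### Step G: the assembly on fixed `n` -/

/-- **The amplified solver solves search-LWE for EVERY secret**, on every dimension `n ≥ 10` on which
the given solver has average-case success `≥ 2/3` (`0 < m`): success probability `≥ 1 − 2^{-(n+1)}`.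
[cite: Regev2009, §2 p. 12 ("solves LWE": for every s, probability exponentially close to 1) with §4 Lemma 4.1 (proof)] -/
theorem success_ge (χ : PMF (ZMod qn)) (hm : 0 < mn) (hn : 10 ≤ n)
    (hA : ENNReal.ofReal (2 / 3) ≤ searchSuccessProb χ mn (Q.searchLWESolver n qn mn)) :
    1 - ENNReal.ofReal ((1 / 2 : ℝ) ^ (n + 1)) ≤ searchSuccessProbOf χ (K0 n * mn) (M.W.searchLWESolver n qn (K0 n * mn)) s := by
  -- pointwise in `S`: success ≥ 1 − fail bound
  set fb : (Fin (K0 n * mn) → (Fin n → ZMod qn) × ZMod qn) → ℝ≥0∞ := fun S =>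
    ENNReal.ofReal (∏ i : Fin (K0 n), ψR Q s (batchOf S i)) / ((NNReal.sqrt 2 : NNReal) : ℝ≥0∞) ^ K0 n with hfb
  have hpt : ∀ S, 1 ≤ (M.W.searchLWESolver n qn (K0 n * mn) S) s + fb S := by
    intro S
    have h1 := M.majEvent_le_success S s
    have h2 : (M.MID.kernel 0 (uIn S)).toOuterMeasure (M.goodEvent S s) ≤ (M.MID.kernel 0 (uIn S)).toOuterMeasure (M.majEvent S s) :=
      PMF.toOuterMeasure_mono _ fun Y hY => M.goodEvent_subset_majEvent S s hm hY.1
    have h3 : 1 - fb S ≤ (M.MID.kernel 0 (uIn S)).toOuterMeasure (M.goodEvent S s) :=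
      one_sub_le_toOuterMeasure_of_compl_le _ _ (M.fail_le S s hm)
    calc (1 : ℝ≥0∞) ≤ 1 - fb S + fb S := le_tsub_add
      _ ≤ _ := add_le_add ((h3.trans h2).trans h1) le_rfl
  -- integrate over the samples
  have hE : ∑' S, lweSamples χ s (K0 n * mn) S * fb S ≤ ENNReal.ofReal ((1 / 2 : ℝ) ^ (n + 1)) := by
    rw [hfb, tsum_fail_eq s χ]
    refine le_trans ?_ (final_bound n)
    gcongr
    refine (tsum_ψR_le s χ hA).trans (ENNReal.ofReal_le_ofReal ?_)
    have := real_bound hn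
    linarith
  rw [searchSuccessProbOf, PMF.bind_apply]
  have hsum : 1 ≤ ∑' S, lweSamples χ s (K0 n * mn) S * (M.W.searchLWESolver n qn (K0 n * mn) S) s +
      ∑' S, lweSamples χ s (K0 n * mn) S * fb S := by
    rw [← ENNReal.tsum_add]
    simp_rw [← mul_add]
    calc (1 : ℝ≥0∞) = ∑' S, lweSamples χ s (K0 n * mn) S := (PMF.tsum_coe _).symm
      _ ≤ _ := ENNReal.tsum_le_tsum fun S => by simpa using mul_le_mul' (le_refl (lweSamples χ s (K0 n * mn) S)) (hpt S)
  calc 1 - ENNReal.ofReal ((1 / 2 : ℝ) ^ (n + 1)) ≤ 1 - ∑' S, lweSamples χ s (K0 n * mn) S * fb S := tsub_le_tsub_left hE 1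
    _ ≤ _ := tsub_le_iff_right.2 hsum

end Machine

/-! ### The parameters `m' = K₀ · m` -/

section Params

/-- `m ↦ K₀ m` preserves polynomial boundedness. [folklore] -/
theorem isPolyBounded_K0_mul {m : ℕ → ℕ} (hm : IsPolyBounded m) : IsPolyBounded fun n => K0 n * m n := by
  obtain ⟨p, hp⟩ := hm
  refine ⟨C 18 * (X + 1) * p, fun n => ?_⟩
  simp only [K0, eval_mul, eval_C, eval_add, eval_X, eval_one]
  exact Nat.mul_le_mul_left _ (hp n)

/-- A parameter computable in polynomial time from `1ⁿ` in binary, as an `FP` function of any string of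
length `n`. [cite: AroraBarak2009, §1.3] -/
theorem mem_FP_of_polyTimeComputable {m : ℕ → ℕ} (h : PolyTimeComputable unaryEncodeNat encodeNat m) :
    (fun z : List Bool => encodeNat (m z.length)) ∈ FP := by
  have hlen : PolyTimeComputable (id : List Bool → List Bool) unaryEncodeNat (List.length : List Bool → ℕ) :=
    PolyTimeComputable.of_encode (f := (List.length : List Bool → ℕ)) onesFn_mem_FP id (fun _ => rfl) (fun _ => rfl)
  have hc := PolyTimeComputable.comp_holds h hlen
  exact PolyTimeComputable.of_encode (f := fun z : List Bool => encodeNat (m z.length)) hc id (fun _ => rfl) (fun _ => rfl)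

/-- **`m ↦ K₀ · m` preserves polynomial-time computability of the parameters.** [cite: AroraBarak2009, §1.3] -/
theorem isPolyTimeParams_K0_mul {q : ℕ → ℕ} {α : ℕ → ℝ} {m : ℕ → ℕ} (h : IsPolyTimeParams q α m) :
    IsPolyTimeParams q α fun n => K0 n * m n := by
  obtain ⟨hq, hm, hα⟩ := h
  refine ⟨hq, ?_, hα⟩
  -- the `FP` function `z ↦ bin (K₀(|z|) · m |z|)`
  have hF : (prodFn ∘ fanoutFn (prodFn ∘ fanoutFn (fun _ => encodeNat 18) (addFn ∘ fanoutFn lenBinF fun _ => encodeNat 1))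
      (fun z : List Bool => encodeNat (m z.length))) ∈ FP :=
    comp_mem_FP prodFn_mem_FP (fanoutFn_mem_FP
      (comp_mem_FP prodFn_mem_FP (fanoutFn_mem_FP (const_mem_FP _) (comp_mem_FP addFn_mem_FP (fanoutFn_mem_FP lenBinF_mem_FP (const_mem_FP _)))))
      (mem_FP_of_polyTimeComputable hm))
  refine PolyTimeComputable.of_encode hF unaryEncodeNat (fun _ => rfl) (fun n => ?_)
  have hn : (unaryEncodeNat n).length = n := unary_decode_encode_nat n
  simp [hn, K0]

end Params

/-! ### Degenerate cases -/

section Degenerate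

variable {n q m : ℕ} [NeZero q]

/-- **With no samples the average-case success probability is `|ℤ_qⁿ|⁻¹`** (the solver's guess is
independent of the secret). [folklore] -/
theorem searchSuccessProb_zero_samples (χ : PMF (ZMod q)) (A : Solver (Fin n) (ZMod q) 0) :
    searchSuccessProb χ 0 A = ((Fintype.card (Fin n → ZMod q) : ℕ) : ℝ≥0∞)⁻¹ := by
  rw [searchSuccessProb]
  have e : ∀ s : Fin n → ZMod q, searchSuccessProbOf χ 0 A s = A Fin.elim0 s := fun s => by
    rw [searchSuccessProbOf, lweSamples, iidPMF_zero, PMF.pure_bind]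
  simp_rw [e, PMF.uniformOfFintype_apply, ← Finset.mul_sum]
  rw [← tsum_univ, PMF.tsum_coe, mul_one]

/-- On a one-element secret space every solver succeeds. [folklore] -/
theorem searchSuccessProbOf_eq_one_of_subsingleton [Subsingleton (Fin n → ZMod q)] (χ : PMF (ZMod q)) (A : Solver (Fin n) (ZMod q) m)
    (s : Fin n → ZMod q) : searchSuccessProbOf χ m A s = 1 := by
  rw [searchSuccessProbOf, ← PMF.tsum_coe ((lweSamples χ s m).bind A)]
  haveI : Unique (Fin n → ZMod q) := uniqueOfSubsingleton s
  rw [tsum_univ, Finset.univ_unique, Finset.sum_singleton]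
  congr 1
  exact Subsingleton.elim _ _

end Degenerate

/-! ### The theorem -/

/-- The target failure: `2^{-n} ≥ (1/2)^{n+1}`, in the form the worst-case predicate asks for. [folklore] -/
theorem ofReal_one_sub_rpow_le (n : ℕ) :
    ENNReal.ofReal (1 - (2 : ℝ) ^ (-((1 : ℝ) * n))) ≤ 1 - ENNReal.ofReal ((1 / 2 : ℝ) ^ (n + 1)) := by
  rw [one_mul, Real.rpow_neg (by norm_num), Real.rpow_natCast, ENNReal.ofReal_sub _ (by positivity), ENNReal.ofReal_one]
  refine tsub_le_tsub_left (ENNReal.ofReal_le_ofReal ?_) 1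
  rw [pow_succ, one_div_pow, ← div_eq_mul_one_div, inv_eq_one_div]
  exact div_le_self (by positivity) (by norm_num)

/-- **The average-case-to-worst-case bridge for search-`LWE`** — hypothesis `h₁` of
`regev_lwe_to_sivp_quantum_of_worstCase` (`RegevDGSReductionWorstCase.lean`) as a THEOREM: from ONE
poly-time uniform quantum family solving search-`LWE_{q,Ψ̄_α}` on `m(n)` samples with AVERAGE-case success
probability `≥ 2/3` (for all large `n`), a poly-time uniform quantum family solving it for EVERY secret
with probability `≥ 1 − 2^{-n}` on `m'(n) = 18(n+1) · m(n)` samples (Regev 2009, §2 p. 12: "an algorithm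
solves `LWE_{p,χ}` if, for any `s`, given samples from `A_{s,χ}` it outputs `s` with probability
exponentially close to `1`"; proof: the shift `(a, b) ↦ (a, b + ⟨a, t⟩)` of the proof of Lemma 4.1 makes
every attempt average-case; `18(n+1)` attempts on disjoint batches with fresh Hadamard coins; majority).
The machine is `Machine.W` (`CoinPrefix` + `CWrap` around the given family, `PolyCopiesIdx` copies,
`CWrap` with the majority map); the estimate is `Machine.success_ge`. The hypotheses on `α` are not used
by the bridge (it works for every noise law). [cite: Regev2009, §2 p. 12 and §4 Lemma 4.1 (proof)] -/
theorem searchLWE_worstCase_of_avgCase (q : ℕ → ℕ) [∀ n, NeZero (q n)] (α : ℕ → ℝ) (m : ℕ → ℕ) :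
    ∀ (_ : IsPolyBounded m) (_ : IsPolyTimeParams q α m)
      (_ : ∀ᶠ n : ℕ in atTop, 0 < α n ∧ α n < 1 ∧ 2 * Real.sqrt n < α n * q n)
      (_ : ∃ Q : UniformQCircuitFamily, SearchLWESolves q (fun n => discretizedGaussian (q n) (α n))
        m (fun n => Q.searchLWESolver n (q n) (m n)) fun _ => 2 / 3),
      ∃ (W : UniformQCircuitFamily) (m' : ℕ → ℕ) (c : ℝ), IsPolyBounded m' ∧
        IsPolyTimeParams q α m' ∧ 0 < c ∧
        W.SolvesSearchLWEWorstCase q (fun n => discretizedGaussian (q n) (α n)) m'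
          fun n => (2 : ℝ) ^ (-(c * n)) := by
  intro hm hpar _ hLWE
  obtain ⟨Q, hQ⟩ := hLWE
  obtain ⟨M⟩ := nonempty_machine Q
  refine ⟨M.W, fun n => K0 n * m n, 1, isPolyBounded_K0_mul hm, isPolyTimeParams_K0_mul hpar, one_pos, ?_⟩
  rw [UniformQCircuitFamily.solvesSearchLWEWorstCase_iff]
  filter_upwards [hQ, eventually_ge_atTop 10] with n hA hn s
  refine (ofReal_one_sub_rpow_le n).trans ?_
  -- the degenerate modulus `q n = 1`: one secret, always found
  by_cases hq1 : q n = 1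
  · haveI : Subsingleton (ZMod (q n)) := by rw [hq1]; infer_instance
    haveI : Subsingleton (Fin n → ZMod (q n)) := inferInstance
    rw [searchSuccessProbOf_eq_one_of_subsingleton]
    exact tsub_le_self
  -- otherwise `m n ≥ 1` (with no samples the average-case success would be `≤ 1/2 < 2/3`)
  have hq2 : 2 ≤ q n := by have := Nat.pos_of_ne_zero (NeZero.ne (q n)); omega
  have hm1 : 0 < m n := by
    by_contra h0
    have hm0 : m n = 0 := Nat.eq_zero_of_not_pos h0
    have hA0 : ENNReal.ofReal (2 / 3) ≤ ((Fintype.card (Fin n → ZMod (q n)) : ℕ) : ℝ≥0∞)⁻¹ := by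
      have key : ∀ (k : ℕ) (A : Solver (Fin n) (ZMod (q n)) k), k = 0 →
          ENNReal.ofReal (2 / 3) ≤ searchSuccessProb (discretizedGaussian (q n) (α n)) k A →
          ENNReal.ofReal (2 / 3) ≤ ((Fintype.card (Fin n → ZMod (q n)) : ℕ) : ℝ≥0∞)⁻¹ := by
        rintro k A rfl h
        rwa [searchSuccessProb_zero_samples] at h
      exact key (m n) _ hm0 hA
    have hcard : (2 : ℝ≥0∞) ≤ ((Fintype.card (Fin n → ZMod (q n)) : ℕ) : ℝ≥0∞) := by
      rw [Fintype.card_fun, Fintype.card_fin, ZMod.card]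
      have : 2 ≤ q n ^ n := le_trans hq2 (Nat.le_self_pow (by omega) _)
      exact_mod_cast this
    have h2 : ((Fintype.card (Fin n → ZMod (q n)) : ℕ) : ℝ≥0∞)⁻¹ ≤ 2⁻¹ := ENNReal.inv_le_inv.2 hcard
    have h3 : ENNReal.ofReal (2 / 3) ≤ 2⁻¹ := hA0.trans h2
    rw [show (2 : ℝ≥0∞)⁻¹ = ENNReal.ofReal (1 / 2) by rw [ENNReal.ofReal_div_of_pos two_pos]; simp,
      ENNReal.ofReal_le_ofReal_iff (by norm_num)] at h3
    norm_num at h3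
  exact M.success_ge s (discretizedGaussian (q n) (α n)) hm1 hn hA

end AmpBricks

end LWE

/-! ### Export under the grouping namespace `Regev2009` -/

/-- **Regev 2009, the "solves LWE" bridge (§2 p. 12 with the proof of Lemma 4.1)**: hypothesis `h₁` of
`regev_lwe_to_sivp_quantum_of_worstCase` holds unconditionally.
[cite: Regev2009, §2 p. 12 and §4 Lemma 4.1 (proof)] -/
theorem Regev2009.searchLWE_worstCase_of_avgCase (q : ℕ → ℕ) [∀ n, NeZero (q n)] (α : ℕ → ℝ) (m : ℕ → ℕ) :
    ∀ (_ : LWE.IsPolyBounded m) (_ : IsPolyTimeParams q α m)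
      (_ : ∀ᶠ n : ℕ in Filter.atTop, 0 < α n ∧ α n < 1 ∧ 2 * Real.sqrt n < α n * q n)
      (_ : ∃ Q : UniformQCircuitFamily, SearchLWESolves q (fun n => LWE.discretizedGaussian (q n) (α n))
        m (fun n => Q.searchLWESolver n (q n) (m n)) fun _ => 2 / 3),
      ∃ (W : UniformQCircuitFamily) (m' : ℕ → ℕ) (c : ℝ), LWE.IsPolyBounded m' ∧
        IsPolyTimeParams q α m' ∧ 0 < c ∧
        W.SolvesSearchLWEWorstCase q (fun n => LWE.discretizedGaussian (q n) (α n)) m'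
          fun n => (2 : ℝ) ^ (-(c * n)) :=
  LWE.AmpBricks.searchLWE_worstCase_of_avgCase q α m

/-! ### The SIVP assembly from two printed results -/

section TwoChildren

open Filter Literature.Computability.Complexity Literature.Computability.Cryptography.LWE Literature.Algebra.EuclideanLattices

variable (q : ℕ → ℕ) [∀ n, NeZero (q n)] (α : ℕ → ℝ) (m : ℕ → ℕ)

/-- **pqc.S19 (SIVP form) from TWO printed results.** With the average-case bridge `h₁` now a theorem
(`Regev2009.searchLWE_worstCase_of_avgCase`), the assembly
`regev_lwe_to_sivp_quantum_of_worstCase` needs only Regev's Thm 3.1 in its printed worst-case-oracle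
form (`h₂`) and Lemma 3.17 (`h₃`). [cite: Regev2009, Thm 3.1 and Lemma 3.17] -/
theorem regev_lwe_to_sivp_quantum_of_thm31_of_lemma317
    (h₂ : ∀ (m' : ℕ → ℕ) (_ : IsPolyBounded m') (_ : IsPolyTimeParams q α m')
      (_ : ∀ᶠ n : ℕ in atTop, 0 < α n ∧ α n < 1 ∧ 2 * Real.sqrt n < α n * q n)
      (_ : ∃ (W : UniformQCircuitFamily) (c : ℝ), 0 < c ∧
        W.SolvesSearchLWEWorstCase q (fun n => discretizedGaussian (q n) (α n)) m'
          fun n => (2 : ℝ) ^ (-(c * n)))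
      (ε : ℕ → ℝ), IsNegligible ε → (∀ n, 0 < ε n) →
      ∃ (D : UniformQCircuitFamily) (ν : ℕ → ℝ), IsNegligible ν ∧ D.SamplesDGS (regevDGSBound α ε) ν)
    (h₃ : ∀ (ε : ℕ → ℝ) (φ : LatticeInstance → ℝ), (∀ n, 0 < ε n ∧ ε n ≤ 1 / 10) →
      (∀ᶠ n in atTop, ∀ I : LatticeInstance, I.n = n → I.IsNonsingular →
        Real.sqrt 2 * smoothingParameter I.lattice (ε n) ≤ φ I) →
      ∀ (D : UniformQCircuitFamily) (ν : ℕ → ℝ), IsNegligible ν → D.SamplesDGS φ ν →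
        ∃ G : UniformQCircuitFamily, G.SolvesGIVP fun I => 2 * Real.sqrt I.n * φ I) :
    regev_lwe_to_sivp_quantum q α m :=
  regev_lwe_to_sivp_quantum_of_worstCase q α m (Regev2009.searchLWE_worstCase_of_avgCase q α m) h₂ h₃

end TwoChildren

end Literature.Computability.Cryptography
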